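import Literature.MathematicalPhysics.KineticTheory.HardSphereEulerProofs
import Literature.Probability.Divergences.RenyiDivergence
import HarnessLib

/-!
# Explicit one-body Rényi cost between two local Gibbs laws (stub S4)

Helper file (`--supports stmt-AtomisticToContinuum-15145`) proving the registered stub
`stub_hellingerLocalGibbsLe` of the lead's skeleton for the crux
`Summit.AtomisticToContinuum.HydrodynamicLimit.Theses.TwoClocks.ClampedEntropyClock`
(line `IdeatorTwoSketch`): for two local Gibbs laws `ψ = (a, u, θ)`, `ψ' = (a', u', θ')` of the SAME
`N + 1`-sphere system (`σ ≤ 1/2`, continuous positive profiles, `(q-1) θ' < q θ` pointwise, `q > 1`)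
the order-`q` Hellinger integral is bounded by a one-body quantity to the power `N + 1`:
`∫ (dψ'/dψ)^q dψ ≤ [(sup a/a')^q · sup_x (a'/a)^q(x) ∫ M'_{x}^q M_{x}^{1-q} dv]^{N+1}`.

Proof summary.
* §1 The Gaussian factor: completing the square,
  `M'^q M^{1-q} = C · M_{1, c, 1/φ}` pointwise (`φ = q/θ' − (q−1)/θ > 0`), so `v ↦ M'^q M^{1-q}` is
  integrable with integral the explicit constant `C`, continuous in the profiles at `x`; hence
  `x ↦ (a'/a)^q(x) ∫ M'^q M^{1-q}` is continuous on the compact torus and its `⨆` is a genuine sup.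
* §2 Both laws are `volume.withDensity ρ`, `ρ'` with densities vanishing exactly off the hard-sphere
  domain, so `ψ' = ψ.withDensity (ρ'/ρ)`, `ψ' ≪ ψ`, `dψ'/dψ = ρ'/ρ` a.e., and the Hellinger integral is
  `∫⁻ (ρ'/ρ)^q dψ` (`hellingerIntegral_of_ac`). The disintegration `lintegral_localGibbsMeasure`
  reduces it to a position integral of a product of one-coordinate Gaussian integrals
  `∫ (M'/M)^q dN(u,θ) = ∫ M'^q M^{1-q} dv`; each coordinate is bounded by the sup `S`, the ratio of
  partition functions by `(sup a/a')^{N+1}` (`posWeight a ≤ (sup a/a')^{N+1} posWeight a'`), and the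
  remaining position density integrates to one (`lintegral_posWeight_eq_one`).
-/

noncomputable section

open MeasureTheory Set Filter
open scoped ENNReal

namespace Summit.AtomisticToContinuum.HydrodynamicLimit.Theorems.QuenchedCellClock

open Literature.MathematicalPhysics.KineticTheory Literature.Analysis.FluidPDE
open Literature.Probability.Divergences

/-! ### §1 The Gaussian factor `∫ M'^q M^{1-q} dv` -/

/-- **Completing the square** in `ℝ³`: for `α ≠ β`,
`-(α/2)|v-u'|² + (β/2)|v-u|² = -((α-β)/2)|v - c|² + R` with `c = (α u' - β u)/(α-β)` and
`R = (β/2)|u|² - (α/2)|u'|² + |α u' - β u|²/(2(α-β))`. [folklore] -/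
theorem gauss_complete_square (α β : ℝ) (hφ : α - β ≠ 0) (v u u' : V3) :
    -(α / 2) * ‖v - u'‖ ^ 2 + β / 2 * ‖v - u‖ ^ 2 =
      -((α - β) / 2) * ‖v - (α - β)⁻¹ • (α • u' - β • u)‖ ^ 2 +
        (β / 2 * ‖u‖ ^ 2 - α / 2 * ‖u'‖ ^ 2 + (α - β)⁻¹ / 2 * ‖α • u' - β • u‖ ^ 2) := by
  simp only [EuclideanSpace.real_norm_sq_eq, PiLp.sub_apply, PiLp.smul_apply, smul_eq_mul,
    Fin.sum_univ_three]
  field_simp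
  ring

/-- **The integrand of the Gaussian factor is a Maxwellian**: for `θ, θ' > 0` and
`(q-1) θ' < q θ` (i.e. `φ := q/θ' - (q-1)/θ > 0`),
`M_{1,u',θ'}(v)^q M_{1,u,θ}(v)^{1-q} = C · M_{1, c, φ⁻¹}(v)` with the explicit constant
`C = (2πθ')^{-3q/2} (2πθ)^{-3(1-q)/2} e^{R} (2π/φ)^{3/2}`. [folklore] -/
theorem rpow_localMaxwellian_mul_rpow_eq {q θ θ' : ℝ} (hθ : 0 < θ) (hθ' : 0 < θ')
    (hqθ : (q - 1) * θ' < q * θ) (u u' v : V3) :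
    localMaxwellian 1 θ' u' v ^ q * localMaxwellian 1 θ u v ^ (1 - q) =
      ((2 * Real.pi * θ') ^ (-(3 : ℝ) / 2 * q) * (2 * Real.pi * θ) ^ (-(3 : ℝ) / 2 * (1 - q)) *
        Real.exp ((q - 1) / θ / 2 * ‖u‖ ^ 2 - q / θ' / 2 * ‖u'‖ ^ 2 +
          (q / θ' - (q - 1) / θ)⁻¹ / 2 * ‖(q / θ') • u' - ((q - 1) / θ) • u‖ ^ 2) *
        (2 * Real.pi * (q / θ' - (q - 1) / θ)⁻¹) ^ ((3 : ℝ) / 2)) *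
      localMaxwellian 1 (q / θ' - (q - 1) / θ)⁻¹
        ((q / θ' - (q - 1) / θ)⁻¹ • ((q / θ') • u' - ((q - 1) / θ) • u)) v := by
  set α := q / θ' with hα
  set β := (q - 1) / θ with hβ
  have hφ : 0 < α - β := by
    rw [hα, hβ, div_sub_div _ _ hθ'.ne' hθ.ne']
    exact div_pos (by nlinarith) (mul_pos hθ' hθ)
  have hfin : (Module.finrank ℝ V3 : ℝ) = 3 := by simp
  have h2θ : 0 < 2 * Real.pi * θ := by positivity
  have h2θ' : 0 < 2 * Real.pi * θ' := by positivity
  have hP : 0 < 2 * Real.pi * (α - β)⁻¹ := by positivity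
  simp only [localMaxwellian, one_mul, hfin]
  rw [Real.mul_rpow (Real.rpow_nonneg h2θ'.le _) (Real.exp_nonneg _),
    Real.mul_rpow (Real.rpow_nonneg h2θ.le _) (Real.exp_nonneg _),
    ← Real.rpow_mul h2θ'.le, ← Real.rpow_mul h2θ.le, ← Real.exp_mul, ← Real.exp_mul]
  have hexp : -‖v - u'‖ ^ 2 / (2 * θ') * q = -(α / 2) * ‖v - u'‖ ^ 2 := by
    rw [hα]; ring
  have hexp' : -‖v - u‖ ^ 2 / (2 * θ) * (1 - q) = β / 2 * ‖v - u‖ ^ 2 := by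
    rw [hβ]; ring
  have htail : -‖v - (α - β)⁻¹ • (α • u' - β • u)‖ ^ 2 / (2 * (α - β)⁻¹) =
      -((α - β) / 2) * ‖v - (α - β)⁻¹ • (α • u' - β • u)‖ ^ 2 := by
    field_simp
  have hneg : (2 * Real.pi * (α - β)⁻¹) ^ (-(3 : ℝ) / 2) =
      ((2 * Real.pi * (α - β)⁻¹) ^ ((3 : ℝ) / 2))⁻¹ := by
    rw [show -(3 : ℝ) / 2 = -((3 : ℝ) / 2) by ring, Real.rpow_neg hP.le]
  rw [hexp, hexp', htail, hneg]
  have hsq := gauss_complete_square α β hφ.ne' v u u'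
  have hPne : (2 * Real.pi * (α - β)⁻¹) ^ ((3 : ℝ) / 2) ≠ 0 := (Real.rpow_pos_of_pos hP _).ne'
  calc (2 * Real.pi * θ') ^ (-(3 : ℝ) / 2 * q) * Real.exp (-(α / 2) * ‖v - u'‖ ^ 2) *
        ((2 * Real.pi * θ) ^ (-(3 : ℝ) / 2 * (1 - q)) * Real.exp (β / 2 * ‖v - u‖ ^ 2))
      = (2 * Real.pi * θ') ^ (-(3 : ℝ) / 2 * q) * (2 * Real.pi * θ) ^ (-(3 : ℝ) / 2 * (1 - q)) *
          Real.exp (-(α / 2) * ‖v - u'‖ ^ 2 + β / 2 * ‖v - u‖ ^ 2) := by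
        rw [Real.exp_add]; ring
    _ = _ := by
        rw [hsq, Real.exp_add]
        field_simp

/-- **The Gaussian factor in closed form**: for `θ, θ' > 0` and `(q-1) θ' < q θ` the function
`v ↦ M_{1,u',θ'}(v)^q M_{1,u,θ}(v)^{1-q}` is integrable on `ℝ³` and its integral is the explicit
constant `C` of `rpow_localMaxwellian_mul_rpow_eq` (a Maxwellian has unit mass). [folklore] -/
theorem integral_rpow_localMaxwellian_mul_rpow {q θ θ' : ℝ} (hθ : 0 < θ) (hθ' : 0 < θ')
    (hqθ : (q - 1) * θ' < q * θ) (u u' : V3) :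
    Integrable (fun v => localMaxwellian 1 θ' u' v ^ q * localMaxwellian 1 θ u v ^ (1 - q)) ∧
    ∫ v, localMaxwellian 1 θ' u' v ^ q * localMaxwellian 1 θ u v ^ (1 - q) =
      (2 * Real.pi * θ') ^ (-(3 : ℝ) / 2 * q) * (2 * Real.pi * θ) ^ (-(3 : ℝ) / 2 * (1 - q)) *
        Real.exp ((q - 1) / θ / 2 * ‖u‖ ^ 2 - q / θ' / 2 * ‖u'‖ ^ 2 +
          (q / θ' - (q - 1) / θ)⁻¹ / 2 * ‖(q / θ') • u' - ((q - 1) / θ) • u‖ ^ 2) *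
        (2 * Real.pi * (q / θ' - (q - 1) / θ)⁻¹) ^ ((3 : ℝ) / 2) := by
  have hφ : 0 < q / θ' - (q - 1) / θ := by
    rw [div_sub_div _ _ hθ'.ne' hθ.ne']
    exact div_pos (by nlinarith) (mul_pos hθ' hθ)
  have hfun : (fun v => localMaxwellian 1 θ' u' v ^ q * localMaxwellian 1 θ u v ^ (1 - q)) =
      fun v => _ * localMaxwellian 1 (q / θ' - (q - 1) / θ)⁻¹
        ((q / θ' - (q - 1) / θ)⁻¹ • ((q / θ') • u' - ((q - 1) / θ) • u)) v :=
    funext fun v => rpow_localMaxwellian_mul_rpow_eq hθ hθ' hqθ u u' v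
  rw [hfun]
  refine ⟨(integrable_localMaxwellian (inv_pos.2 hφ) _).const_mul _, ?_⟩
  rw [integral_const_mul, integral_localMaxwellian_one (inv_pos.2 hφ), mul_one]

/-- **Continuity of the one-body Rényi cost in the macroscopic point**: for continuous profiles
`a, a', θ, θ' > 0`, `u, u'` with `(q-1) θ' < q θ` pointwise (`q > 1`), the closed form of
`x ↦ (a'(x)/a(x))^q ∫ M'_x^q M_x^{1-q} dv` is continuous on `𝕋³`. [folklore] -/
theorem continuous_gaussFactor {q : ℝ} (hq : 1 < q) {a θ a' θ' : T3 → ℝ} {u u' : T3 → V3}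
    (ha : Continuous a) (hθ : Continuous θ) (hu : Continuous u)
    (ha' : Continuous a') (hθ' : Continuous θ') (hu' : Continuous u')
    (ha0 : ∀ x, 0 < a x) (hθ0 : ∀ x, 0 < θ x) (hθ0' : ∀ x, 0 < θ' x)
    (hqθ : ∀ x, (q - 1) * θ' x < q * θ x) :
    Continuous fun y => (a' y / a y) ^ q *
      ((2 * Real.pi * θ' y) ^ (-(3 : ℝ) / 2 * q) * (2 * Real.pi * θ y) ^ (-(3 : ℝ) / 2 * (1 - q)) *
        Real.exp ((q - 1) / θ y / 2 * ‖u y‖ ^ 2 - q / θ' y / 2 * ‖u' y‖ ^ 2 +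
          (q / θ' y - (q - 1) / θ y)⁻¹ / 2 * ‖(q / θ' y) • u' y - ((q - 1) / θ y) • u y‖ ^ 2) *
        (2 * Real.pi * (q / θ' y - (q - 1) / θ y)⁻¹) ^ ((3 : ℝ) / 2)) := by
  have hφ : ∀ y, q / θ' y - (q - 1) / θ y ≠ 0 := fun y => by
    rw [div_sub_div _ _ (hθ0' y).ne' (hθ0 y).ne']
    exact (div_pos (by nlinarith [hqθ y, hθ0 y, hθ0' y]) (mul_pos (hθ0' y) (hθ0 y))).ne'
  have hθne : ∀ y, θ y ≠ 0 := fun y => (hθ0 y).ne'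
  have hθne' : ∀ y, θ' y ≠ 0 := fun y => (hθ0' y).ne'
  have hane : ∀ y, a y ≠ 0 := fun y => (ha0 y).ne'
  refine ((ha'.div₀ ha hane).rpow_const fun y => Or.inr (by linarith)).mul ?_
  refine ((Continuous.mul ?_ ?_).mul ?_).mul ?_
  · exact (continuous_const.mul hθ').rpow_const fun y =>
      Or.inl (mul_pos (by positivity) (hθ0' y)).ne'
  · exact (continuous_const.mul hθ).rpow_const fun y =>
      Or.inl (mul_pos (by positivity) (hθ0 y)).ne'
  · exact Real.continuous_exp.comp (by fun_prop (disch := first | assumption | (intro; positivity)))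
  · exact (continuous_const.mul (((continuous_const.div₀ hθ' hθne').sub
      (continuous_const.div₀ hθ hθne)).inv₀ hφ)).rpow_const fun y => Or.inr (by norm_num)

/-- **One Maxwellian coordinate**: `∫ (M'/M)^q dN(u, θ) = ∫ M'^q M^{1-q} dv` (as an `ℝ≥0∞`
identity; `N(u, θ) = M_{1,u,θ} dv` and `M (M'/M)^q = M'^q M^{1-q}` since `M > 0`). [folklore] -/
theorem lintegral_gaussMeasure_ratio_rpow {q θ θ' : ℝ} (hθ : 0 < θ) (hθ' : 0 < θ')
    (hqθ : (q - 1) * θ' < q * θ) (u u' : V3) :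
    ∫⁻ w, ENNReal.ofReal ((localMaxwellian 1 θ' u' w / localMaxwellian 1 θ u w) ^ q)
        ∂gaussMeasure u θ =
      ENNReal.ofReal (∫ w, localMaxwellian 1 θ' u' w ^ q * localMaxwellian 1 θ u w ^ (1 - q)) := by
  have hM : ∀ w, 0 < localMaxwellian 1 θ u w := fun w => localMaxwellian_pos one_pos hθ u w
  have hM' : ∀ w, 0 < localMaxwellian 1 θ' u' w := fun w => localMaxwellian_pos one_pos hθ' u' w
  have hmeas : Measurable fun w =>
      ENNReal.ofReal ((localMaxwellian 1 θ' u' w / localMaxwellian 1 θ u w) ^ q) :=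
    (((continuous_localMaxwellian 1 θ' u').measurable.div
      (continuous_localMaxwellian 1 θ u).measurable).pow_const q).ennreal_ofReal
  rw [← withDensity_localMaxwellian_eq_gaussMeasure hθ u,
    lintegral_withDensity_eq_lintegral_mul _
      (continuous_localMaxwellian 1 θ u).measurable.ennreal_ofReal hmeas,
    ofReal_integral_eq_lintegral_ofReal (integral_rpow_localMaxwellian_mul_rpow hθ hθ' hqθ u u').1
      (Eventually.of_forall fun w =>
        mul_nonneg (Real.rpow_nonneg (hM' w).le _) (Real.rpow_nonneg (hM w).le _))]
  refine lintegral_congr fun w => ?_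
  rw [Pi.mul_apply, ← ENNReal.ofReal_mul (hM w).le]
  congr 1
  rw [Real.div_rpow (hM' w).le (hM w).le, Real.rpow_sub (hM w), Real.rpow_one]
  field_simp

/-! ### §2 The partition functions and the main estimate -/

/-- **Ratio of configurational partition functions**: `posWeight a ≤ (sup a/a')^{n} posWeight a'`
pointwise (same hard-core indicator), hence `Z_pos(a) ≤ (sup a/a')^{n} Z_pos(a')`. [folklore] -/
theorem posPartition_le_ciSup_pow_mul {a a' : T3 → ℝ} (ha : Continuous a) (ha' : Continuous a')
    (ha0 : ∀ x, 0 < a x) (ha0' : ∀ x, 0 < a' x) (ε : ℝ) (n : ℕ) :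
    posPartition a ε n ≤ (⨆ x, a x / a' x) ^ n * posPartition a' ε n := by
  have hbdd : BddAbove (Set.range fun x => a x / a' x) :=
    (isCompact_range (ha.div₀ ha' fun x => (ha0' x).ne')).bddAbove
  have hle : ∀ y, a y ≤ (⨆ x, a x / a' x) * a' y := fun y =>
    (div_le_iff₀ (ha0' y)).1 (le_ciSup hbdd y)
  have hpt : ∀ x, posWeight a ε n x ≤ (⨆ x, a x / a' x) ^ n * posWeight a' ε n x := by
    intro x
    by_cases hx : x ∈ posDomain ε n
    · rw [posWeight, posWeight, Set.indicator_of_mem hx, Set.indicator_of_mem hx]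
      calc ∏ i, a (x i) ≤ ∏ i, (⨆ x, a x / a' x) * a' (x i) :=
            Finset.prod_le_prod (fun i _ => (ha0 _).le) fun i _ => hle _
        _ = (⨆ x, a x / a' x) ^ n * ∏ i, a' (x i) := by
            rw [Finset.prod_mul_distrib, Finset.prod_const, Finset.card_univ, Fintype.card_fin]
    · rw [posWeight, posWeight, Set.indicator_of_notMem hx, Set.indicator_of_notMem hx, mul_zero]
  calc posPartition a ε n = ∫ x, posWeight a ε n x := rfl
    _ ≤ ∫ x, (⨆ x, a x / a' x) ^ n * posWeight a' ε n x :=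
        integral_mono (integrable_posWeight ha (fun x => (ha0 x).le) ε n)
          ((integrable_posWeight ha' (fun x => (ha0' x).le) ε n).const_mul _) hpt
    _ = (⨆ x, a x / a' x) ^ n * posPartition a' ε n := by
        rw [integral_const_mul]; rfl

/-- **Stub S4 — explicit one-body Rényi cost between two local Gibbs laws of the SAME hard-sphere system.**
Both laws share the hard-core indicator, velocities are conditionally Maxwellian given positions, and a
ratio of configurational partition functions with one-body weights `a ≤ C a'` is `≤ C^{N+1}`; the velocity
factor is the explicit Gaussian integral `∫ M'^q M^{1-q} dv`, finite iff `(q-1) θ' < q θ` pointwise: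
`∫ (dψ'/dψ)^q dψ ≤ [ (sup a/a')^q · sup_x (a'/a)^q ∫ M_{θ',u'}^q M_{θ,u}^{1-q} dv ]^{N+1}`. [folklore] -/
theorem stub_hellingerLocalGibbsLe {σ : ℝ} (_hσ : 0 < σ) (hσ2 : σ ≤ 1 / 2) {q : ℝ} (hq : 1 < q)
    (a θ a' θ' : T3 → ℝ) (u u' : T3 → V3)
    (ha : Continuous a) (hθ : Continuous θ) (hu : Continuous u)
    (ha' : Continuous a') (hθ' : Continuous θ') (hu' : Continuous u')
    (ha0 : ∀ x, 0 < a x) (hθ0 : ∀ x, 0 < θ x) (ha0' : ∀ x, 0 < a' x) (hθ0' : ∀ x, 0 < θ' x)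
    (hqθ : ∀ x, (q - 1) * θ' x < q * θ x) (N : ℕ)
    (Φ : HardSphereFlow (Torus.geometry (Fin 3)) (hsDiameter σ N) (N + 1)) :
    hellingerIntegral q (localGibbsLaw σ a' u' θ' N Φ) (localGibbsLaw σ a u θ N Φ) ≤
      ENNReal.ofReal (((⨆ x, a x / a' x) ^ q *
        (⨆ x, (a' x / a x) ^ q *
          ∫ v, localMaxwellian 1 (θ' x) (u' x) v ^ q * localMaxwellian 1 (θ x) (u x) v ^ (1 - q)))
        ^ (N + 1)) := by
  /- Step 0: notation, positivity, the two sups are genuine. -/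
  have hq0 : 0 ≤ q := by linarith
  have ha0le : ∀ x, 0 ≤ a x := fun x => (ha0 x).le
  have ha0le' : ∀ x, 0 ≤ a' x := fun x => (ha0' x).le
  set ε := hsDiameter σ N
  set A : ℝ := ⨆ x, a x / a' x
  set s : T3 → ℝ := fun x => (a' x / a x) ^ q *
    ∫ v, localMaxwellian 1 (θ' x) (u' x) v ^ q * localMaxwellian 1 (θ x) (u x) v ^ (1 - q)
  have hbddA : BddAbove (Set.range fun x => a x / a' x) :=
    (isCompact_range (ha.div₀ ha' fun x => (ha0' x).ne')).bddAbove
  have hA0 : 0 ≤ A := le_ciSup_of_le hbddA 0 (div_nonneg (ha0le 0) (ha0le' 0))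
  have hbddS : BddAbove (Set.range s) := by
    have : s = _ := funext fun y => congrArg (fun r => (a' y / a y) ^ q * r)
      (integral_rpow_localMaxwellian_mul_rpow (hθ0 y) (hθ0' y) (hqθ y) (u y) (u' y)).2
    rw [this]
    exact (isCompact_range (continuous_gaussFactor hq ha hθ hu ha' hθ' hu' ha0 hθ0 hθ0' hqθ)).bddAbove
  have hint0 : ∀ y, 0 ≤ ∫ v, localMaxwellian 1 (θ' y) (u' y) v ^ q *
      localMaxwellian 1 (θ y) (u y) v ^ (1 - q) := fun y =>
    integral_nonneg fun v => mul_nonneg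
      (Real.rpow_nonneg (localMaxwellian_pos one_pos (hθ0' y) _ _).le _)
      (Real.rpow_nonneg (localMaxwellian_pos one_pos (hθ0 y) _ _).le _)
  have hs0 : ∀ y, 0 ≤ s y := fun y =>
    mul_nonneg (Real.rpow_nonneg (div_nonneg (ha0le' y) (ha0le y)) _) (hint0 y)
  /- Step 1: partition functions. -/
  have hZ : canonicalPartition (Torus.geometry (Fin 3)) ε (N + 1) (localGibbsProfile a u θ) =
      posPartition a ε (N + 1) := canonicalPartition_eq_posPartition ha hθ hu ha0le hθ0 ε (N + 1)
  have hZ' : canonicalPartition (Torus.geometry (Fin 3)) ε (N + 1) (localGibbsProfile a' u' θ') =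
      posPartition a' ε (N + 1) :=
    canonicalPartition_eq_posPartition ha' hθ' hu' ha0le' hθ0' ε (N + 1)
  have hZpos : 0 < posPartition a ε (N + 1) := posPartition_pos ha ha0 hσ2 N
  have hZpos' : 0 < posPartition a' ε (N + 1) := posPartition_pos ha' ha0' hσ2 N
  have hZZ : posPartition a ε (N + 1) / posPartition a' ε (N + 1) ≤ A ^ (N + 1) :=
    (div_le_iff₀ hZpos').2 (posPartition_le_ciSup_pow_mul ha ha' ha0 ha0' ε (N + 1))
  /- Step 2: the densities and their ratio. -/
  set cd : Config (N + 1) (Fin 3) T3 → ℝ :=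
    canonicalDensity (Torus.geometry (Fin 3)) ε (N + 1) (localGibbsProfile a u θ) with hcd
  set cd' : Config (N + 1) (Fin 3) T3 → ℝ :=
    canonicalDensity (Torus.geometry (Fin 3)) ε (N + 1) (localGibbsProfile a' u' θ') with hcd'
  have hcdm : Measurable cd := measurable_canonicalDensity ε (N + 1) (measurable_localGibbsProfile ha hθ hu)
  have hcdm' : Measurable cd' :=
    measurable_canonicalDensity ε (N + 1) (measurable_localGibbsProfile ha' hθ' hu')
  have hcd0 : ∀ z, 0 ≤ cd z := fun z =>
    mul_nonneg (inv_nonneg.2 (canonicalPartition_nonneg _ _ _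
      (fun y => localGibbsProfile_nonneg ha0le (fun x => (hθ0 x).le) y)))
      (Set.indicator_nonneg (fun w _ => tensorPow_nonneg
        (fun y => localGibbsProfile_nonneg ha0le (fun x => (hθ0 x).le) y) _ w) z)
  have hcd0' : ∀ z, 0 ≤ cd' z := fun z =>
    mul_nonneg (inv_nonneg.2 (canonicalPartition_nonneg _ _ _
      (fun y => localGibbsProfile_nonneg ha0le' (fun x => (hθ0' x).le) y)))
      (Set.indicator_nonneg (fun w _ => tensorPow_nonneg
        (fun y => localGibbsProfile_nonneg ha0le' (fun x => (hθ0' x).le) y) _ w) z)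
  have hcdpos : ∀ z ∈ hardSphereDomain (Torus.geometry (Fin 3)) (N + 1) ε, 0 < cd z := by
    intro z hz
    simp only [hcd, canonicalDensity, Set.indicator_of_mem hz, tensorPow]
    rw [hZ]
    exact mul_pos (inv_pos.2 hZpos) (Finset.prod_pos fun i _ =>
      mul_pos (ha0 _) (localMaxwellian_pos one_pos (hθ0 _) _ _))
  set g : Config (N + 1) (Fin 3) T3 → ℝ≥0∞ := fun z => ENNReal.ofReal (cd' z / cd z) with hg
  have hgm : Measurable g := (hcdm'.div hcdm).ennreal_ofReal
  /- Step 3: `ψ' = ψ.withDensity g`, hence `ψ' ≪ ψ` and `dψ'/dψ = g` a.e. -/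
  haveI hprob : IsProbabilityMeasure (localGibbsMeasure σ a u θ N) :=
    isProbabilityMeasure_localGibbsMeasure ha hθ hu ha0 hθ0 hσ2 N
  have hψg : localGibbsMeasure σ a' u' θ' N = (localGibbsMeasure σ a u θ N).withDensity g := by
    simp only [localGibbsMeasure]
    rw [← withDensity_mul _ hcdm.ennreal_ofReal hgm]
    congr 1
    funext z
    show ENNReal.ofReal (cd' z) = ENNReal.ofReal (cd z) * ENNReal.ofReal (cd' z / cd z)
    by_cases hz : z ∈ hardSphereDomain (Torus.geometry (Fin 3)) (N + 1) ε
    · rw [← ENNReal.ofReal_mul (hcd0 z), mul_div_cancel₀ _ (hcdpos z hz).ne']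
    · have h1 : cd z = 0 := canonicalDensity_eq_zero_of_notMem _ _ _ _ hz
      have h2 : cd' z = 0 := canonicalDensity_eq_zero_of_notMem _ _ _ _ hz
      rw [h1, h2]
      simp
  have hac : localGibbsMeasure σ a' u' θ' N ≪ localGibbsMeasure σ a u θ N := by
    rw [hψg]
    exact withDensity_absolutelyContinuous _ _
  have hrn : (localGibbsMeasure σ a' u' θ' N).rnDeriv (localGibbsMeasure σ a u θ N)
      =ᵐ[localGibbsMeasure σ a u θ N] g := by
    rw [hψg]
    exact Measure.rnDeriv_withDensity _ hgm
  /- Step 4: the velocity integral at fixed non-overlapping positions. -/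
  have hvel : ∀ x ∈ posDomain ε (N + 1),
      ∫⁻ v, g (zipConfig (x, v)) ^ q ∂velMeasure u θ x =
        ENNReal.ofReal ((posPartition a ε (N + 1) / posPartition a' ε (N + 1)) ^ q *
          ∏ i, s (x i)) := by
    intro x hx
    have hM : ∀ i (w : V3), 0 < localMaxwellian 1 (θ (x i)) (u (x i)) w := fun i w =>
      localMaxwellian_pos one_pos (hθ0 _) _ w
    have hM' : ∀ i (w : V3), 0 < localMaxwellian 1 (θ' (x i)) (u' (x i)) w := fun i w =>
      localMaxwellian_pos one_pos (hθ0' _) _ w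
    have hK0 : 0 ≤ posPartition a ε (N + 1) / posPartition a' ε (N + 1) *
        ∏ i, a' (x i) / a (x i) :=
      mul_nonneg (div_nonneg hZpos.le hZpos'.le)
        (Finset.prod_nonneg fun i _ => div_nonneg (ha0le' _) (ha0le _))
    have hpt : ∀ v : Fin (N + 1) → V3, g (zipConfig (x, v)) ^ q =
        ENNReal.ofReal ((posPartition a ε (N + 1) / posPartition a' ε (N + 1) *
            ∏ i, a' (x i) / a (x i)) ^ q) *
          ∏ i, ENNReal.ofReal ((localMaxwellian 1 (θ' (x i)) (u' (x i)) (v i) /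
            localMaxwellian 1 (θ (x i)) (u (x i)) (v i)) ^ q) := by
      intro v
      have hratio : cd' (zipConfig (x, v)) / cd (zipConfig (x, v)) =
          (posPartition a ε (N + 1) / posPartition a' ε (N + 1) * ∏ i, a' (x i) / a (x i)) *
            ∏ i, localMaxwellian 1 (θ' (x i)) (u' (x i)) (v i) /
              localMaxwellian 1 (θ (x i)) (u (x i)) (v i) := by
        simp only [hcd, hcd']
        rw [canonicalDensity_zipConfig, canonicalDensity_zipConfig, hZ, hZ', posWeight, posWeight,
          Set.indicator_of_mem hx, Set.indicator_of_mem hx, Finset.prod_div_distrib,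
          Finset.prod_div_distrib]
        have h1 : (∏ i, a (x i)) ≠ 0 := (Finset.prod_pos fun i _ => ha0 (x i)).ne'
        have h2 : (∏ i, localMaxwellian 1 (θ (x i)) (u (x i)) (v i)) ≠ 0 :=
          (Finset.prod_pos fun i _ => hM i (v i)).ne'
        field_simp
      simp only [hg]
      rw [hratio, ENNReal.ofReal_rpow_of_nonneg (mul_nonneg hK0
          (Finset.prod_nonneg fun i _ => (div_pos (hM' i _) (hM i _)).le)) hq0,
        Real.mul_rpow hK0 (Finset.prod_nonneg fun i _ => (div_pos (hM' i _) (hM i _)).le),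
        ENNReal.ofReal_mul (Real.rpow_nonneg hK0 _),
        ← Real.finsetProd_rpow _ _ (fun i _ => (div_pos (hM' i _) (hM i _)).le),
        ENNReal.ofReal_prod_of_nonneg fun i _ =>
          Real.rpow_nonneg (div_pos (hM' i _) (hM i _)).le _]
    simp_rw [hpt]
    rw [lintegral_const_mul' _ _ ENNReal.ofReal_ne_top, velMeasure,
      lintegral_fintype_prod_eq_prod' (fun i => gaussMeasure (u (x i)) (θ (x i)))
        (f := fun i w => ENNReal.ofReal ((localMaxwellian 1 (θ' (x i)) (u' (x i)) w /
          localMaxwellian 1 (θ (x i)) (u (x i)) w) ^ q))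
        fun i => (((continuous_localMaxwellian 1 _ _).measurable.div
          (continuous_localMaxwellian 1 _ _).measurable).pow_const q).ennreal_ofReal]
    simp_rw [lintegral_gaussMeasure_ratio_rpow (hθ0 _) (hθ0' _) (hqθ _)]
    rw [← ENNReal.ofReal_prod_of_nonneg fun i _ => hint0 (x i),
      ← ENNReal.ofReal_mul (Real.rpow_nonneg hK0 _)]
    congr 1
    rw [Real.mul_rpow (div_nonneg hZpos.le hZpos'.le)
        (Finset.prod_nonneg fun i _ => div_nonneg (ha0le' _) (ha0le _)),
      ← Real.finsetProd_rpow _ _ (fun i _ => div_nonneg (ha0le' _) (ha0le _)), mul_assoc,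
      ← Finset.prod_mul_distrib]
  /- Step 5: the real bound at fixed positions. -/
  have hbound : ∀ x : Fin (N + 1) → T3,
      (posPartition a ε (N + 1) / posPartition a' ε (N + 1)) ^ q * ∏ i, s (x i) ≤
        (A ^ q * ⨆ x, s x) ^ (N + 1) := by
    intro x
    rw [mul_pow]
    refine mul_le_mul ?_ ?_ (Finset.prod_nonneg fun i _ => hs0 _) (pow_nonneg (Real.rpow_nonneg hA0 _) _)
    · calc (posPartition a ε (N + 1) / posPartition a' ε (N + 1)) ^ q ≤ (A ^ (N + 1)) ^ q :=
            Real.rpow_le_rpow (div_nonneg hZpos.le hZpos'.le) hZZ hq0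
        _ = (A ^ q) ^ (N + 1) := by
            rw [← Real.rpow_natCast_mul hA0, mul_comm, Real.rpow_mul_natCast hA0]
    · calc ∏ i, s (x i) ≤ ∏ _i : Fin (N + 1), ⨆ x, s x :=
            Finset.prod_le_prod (fun i _ => hs0 _) fun i _ => le_ciSup hbddS (x i)
        _ = (⨆ x, s x) ^ (N + 1) := by
            rw [Finset.prod_const, Finset.card_univ, Fintype.card_fin]
  /- Step 6: assemble. -/
  rw [localGibbsLaw_eq, localGibbsLaw_eq, hellingerIntegral_of_ac hac]
  calc ∫⁻ z, ((localGibbsMeasure σ a' u' θ' N).rnDeriv (localGibbsMeasure σ a u θ N) z) ^ q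
        ∂localGibbsMeasure σ a u θ N
      = ∫⁻ z, g z ^ q ∂localGibbsMeasure σ a u θ N :=
        lintegral_congr_ae (hrn.mono fun z hz => by simp only [hz])
    _ = ∫⁻ x, ENNReal.ofReal ((canonicalPartition (Torus.geometry (Fin 3)) ε (N + 1)
          (localGibbsProfile a u θ))⁻¹ * posWeight a ε (N + 1) x) *
          ∫⁻ v, g (zipConfig (x, v)) ^ q ∂velMeasure u θ x :=
        lintegral_localGibbsMeasure ha hθ hu ha0le hθ0 σ N (hgm.pow_const q)
    _ ≤ ∫⁻ x, ENNReal.ofReal ((canonicalPartition (Torus.geometry (Fin 3)) ε (N + 1)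
          (localGibbsProfile a u θ))⁻¹ * posWeight a ε (N + 1) x) *
          ENNReal.ofReal ((A ^ q * ⨆ x, s x) ^ (N + 1)) := by
        refine lintegral_mono fun x => ?_
        by_cases hx : x ∈ posDomain ε (N + 1)
        · rw [hvel x hx]
          exact mul_le_mul' le_rfl (ENNReal.ofReal_le_ofReal (hbound x))
        · rw [show posWeight a ε (N + 1) x = 0 from Set.indicator_of_notMem hx _, mul_zero,
            ENNReal.ofReal_zero, zero_mul, zero_mul]
    _ = ENNReal.ofReal ((A ^ q * ⨆ x, s x) ^ (N + 1)) := by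
        rw [lintegral_mul_const' _ _ ENNReal.ofReal_ne_top,
          lintegral_posWeight_eq_one ha hθ hu ha0le hθ0 σ N, one_mul]

end Summit.AtomisticToContinuum.HydrodynamicLimit.Theorems.QuenchedCellClock
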